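import Mathlib.MeasureTheory.Constructions.BorelSpace.Real
import Mathlib.MeasureTheory.Measure.Lebesgue.Basic
import Mathlib.MeasureTheory.Group.Measure
import Mathlib.MeasureTheory.Measure.Haar.OfBasis
import Mathlib.MeasureTheory.Function.StronglyMeasurable.AEStronglyMeasurable
import Mathlib.LinearAlgebra.Basis.VectorSpace
import Mathlib.Analysis.Real.Cardinality
import Mathlib.Data.Rat.Denumerable
import Mathlib.Topology.Instances.Rat
import HarnessLib

/-!
# A countable partition of `ℝ` into thick (full outer measure) sets

`Literature/MeasureTheory/Lebesgue`: the classical Hamel-basis companion of Vitali's construction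
(`VitaliSet.lean`). For a Hamel basis of `ℝ` over `ℚ`, a coordinate functional `φ : ℝ →ₗ[ℚ] ℚ`
is surjective and its kernel `Γ` — a `ℚ`-hyperplane of `ℝ` (Kharazishvili 2005, Ch. 9,
Exercise 6) — contains the dense subgroup `ℚ e` spanned by any other basis vector `e`. The fibres
`φ⁻¹{q}`, `q ∈ ℚ`, partition `ℝ` into countably many translates of `Γ`, and each of them is
**thick** in the sense of Halmos 1950, §17: it has full outer Lebesgue measure on every measurable
set, `volume.restrict (φ⁻¹{q}) = volume` (`restrict_fibre_eq_volume`; mechanism of Halmos 1950,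
§16, Thm. E / Exercise (1): a.e.-invariance under a dense set of translations). Packaged as a
class map `k : ℝ → ℕ` with thick fibres (`exists_classMap_restrict_eq_volume`).

The use made of it (`ae_eq_of_aestronglyMeasurable_lift`): if measurable functions `e n : ℝ → ℝ`
are lifted along the class map to `t ↦ e (k t) t`, then a.e.-strong measurability of the lift on
a measurable set `S` forces `e i = e j` a.e. on `S` for all `i, j` — so a lift with genuinely
different branches is not a.e.-strongly measurable, and Bochner integrals of it are Mathlib's junk
value `0` (`MeasureTheory.integral_non_aestronglyMeasurable`). This is the device by which
`Literature/Analysis/FluidPDE/NSLerayHopfABCHolds.lean` shows that a weak formulation whose force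
is not required to be measurable in time is vacuous.

## Mathlib search

Mathlib (this pin) has Hamel bases (`Module.Basis.ofVectorSpace`), `Cardinal.not_countable_real`,
`Real.measure_ext_Ioo_rat`, translation invariance of outer Lebesgue measure
(`measure_preimage_add_right`, valid for all sets), `Measure.restrict` of an arbitrary set and
`Measure.measure_toMeasurable_inter_of_sFinite`; it has no non-measurable set and no thick set
(`lean search 'thick|full outer measure|Bernstein set'`: none; the tree has `VitaliSet.lean`,
inner measure zero / locally positive outer measure, which is a different package).

## References

* A. B. Kharazishvili, *Strange Functions in Real Analysis*, 2nd ed., Chapman & Hall/CRC (2005),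
  Ch. 9 (Hamel basis and Cauchy functional equation), Exercise 6 (the hyperplane `Γ`: countably
  many translates cover `ℝ`; `Γ` is non-measurable), PDF p. 150. [Kharazishvili2005]
* P. R. Halmos, *Measure Theory* (1950), §16 Thm. E (a set `M` with `μ⁎(M ∩ E) = 0`,
  `μ*(M ∩ E) = μ(E)` for all measurable `E`) and Exercise (1) (a measurable set a.e.-invariant
  under a dense set of translations is null or co-null), §17 (thick sets), PDF pp. 84, 87.
  [Halmos1950]
-/

noncomputable section

open MeasureTheory Set Filter Topology

namespace Literature.MeasureTheory.Lebesgue.ThickPartition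

/-- **A `ℚ`-hyperplane of `ℝ`** (Kharazishvili 2005, Ch. 9, Exercise 6: for a Hamel basis
`{eᵢ}` of `ℝ` over `ℚ` and an index `i₀`, the `ℚ`-span `Γ` of `{eᵢ : i ≠ i₀}` is a hyperplane, and
"the real line can be covered by a countable family of translates of `Γ`"). In the form used below:
there is a surjective `ℚ`-linear functional `φ : ℝ → ℚ` (the `i₀`-th coordinate, `Γ = ker φ`) and
a real `r ≠ 0` (another basis vector `e_{i₁}`) all of whose rational multiples lie in `ker φ`. Uses
Mathlib's `Module.Basis.ofVectorSpace ℚ ℝ` (axiom of choice); two distinct basis vectors exist since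
`ℝ` is uncountable (`Cardinal.not_countable_real`). [cite: Kharazishvili2005, Ch. 9 Exercise 6] -/
theorem exists_ratLinear_surjective :
    ∃ (φ : ℝ →ₗ[ℚ] ℚ) (r : ℝ), r ≠ 0 ∧ (∀ q : ℚ, φ ((q : ℝ) * r) = 0) ∧ Function.Surjective φ := by
  classical
  set b := Module.Basis.ofVectorSpace ℚ ℝ with hb
  -- two distinct indices
  have hij : ∃ i j : Module.Basis.ofVectorSpaceIndex ℚ ℝ, i ≠ j := by
    by_contra h
    push Not at h
    have hsub : Subsingleton (Module.Basis.ofVectorSpaceIndex ℚ ℝ) := ⟨h⟩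
    rcases isEmpty_or_nonempty (Module.Basis.ofVectorSpaceIndex ℚ ℝ) with hι | ⟨⟨i₀⟩⟩
    · have h1 : b.repr 1 = 0 := Subsingleton.elim _ _
      have : (1 : ℝ) = 0 := b.repr.map_eq_zero_iff.1 h1
      exact one_ne_zero this
    · have hcount : (Set.univ : Set ℝ).Countable := by
        have hsub' : (Set.univ : Set ℝ) ⊆ Set.range (fun q : ℚ => q • b i₀) := by
          intro x _
          refine ⟨b.repr x i₀, ?_⟩
          have hx : b.repr x = Finsupp.single i₀ (b.repr x i₀) := by
            ext j
            rw [Subsingleton.elim j i₀, Finsupp.single_eq_same]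
          have h2 : b.repr.symm (b.repr x) = x := b.repr.symm_apply_apply x
          rw [hx, Module.Basis.repr_symm_single] at h2
          simpa using h2
        exact (Set.countable_range _).mono hsub'
      exact Cardinal.not_countable_real hcount
  obtain ⟨i, j, hij⟩ := hij
  refine ⟨b.coord i, b j, b.ne_zero j, fun q => ?_, fun q => ⟨(q : ℝ) * b i, ?_⟩⟩
  · rw [← Rat.smul_def, map_smul, Module.Basis.coord_apply, Module.Basis.repr_self,
      Finsupp.single_apply, if_neg hij.symm, smul_zero]
  · rw [← Rat.smul_def, map_smul, Module.Basis.coord_apply, Module.Basis.repr_self,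
      Finsupp.single_eq_same, smul_eq_mul, mul_one]

/-- **Every translate of the hyperplane is thick** (has full outer Lebesgue measure on every
measurable set; Halmos 1950, §17: `X₀` is *thick* iff `μ⁎(E ∖ X₀) = 0` for every measurable `E`,
here in the equivalent form `volume.restrict A = volume`, i.e. `μ*(A ∩ E) = μ(E)`). For `φ`, `r`
as in `exists_ratLinear_surjective` and `q ∈ ℚ`, the fibre `A = φ⁻¹{q}` satisfies
`volume.restrict A = volume`. Proof (the mechanism of Halmos 1950, §16, Thm. E and Exercise (1):
a set a.e.-invariant under a dense set of translations is null or co-null): the measure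
`ρ = volume.restrict A` (an honest measure, the outer measure of `A ∩ ·` on measurable sets) is
invariant under the dense group of translations `ℚ r ⊆ ker φ` and `s ↦ ρ (s, s + ℓ)` is
`2`-Lipschitz, hence constant; additivity then gives `ρ (a, b) = c (b - a)` for rational `a < b`,
so `ρ = c • volume` (`Real.measure_ext_Ioo_rat`); testing on the complement of the measurable hull
of `A` gives `c = 0` or the hull is co-null, and `c = 0` is absurd because the countably many
translates `φ⁻¹{q'}` of `A` cover `ℝ` (Kharazishvili, loc. cit., (a)). [cite: Halmos1950, §16 Thm. E with Exercise (1); §17 (thick sets)] -/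
theorem restrict_fibre_eq_volume {φ : ℝ →ₗ[ℚ] ℚ} {r : ℝ} (hr : r ≠ 0)
    (hker : ∀ q : ℚ, φ ((q : ℝ) * r) = 0) (hsurj : Function.Surjective φ) (q : ℚ) :
    (volume : Measure ℝ).restrict (φ ⁻¹' {q}) = volume := by
  set A : Set ℝ := φ ⁻¹' {q} with hA
  set ρ : Measure ℝ := (volume : Measure ℝ).restrict A with hρ
  have hρle : ρ ≤ volume := Measure.restrict_le_self
  have hρle' : ∀ s : Set ℝ, ρ s ≤ volume s := fun s => Measure.le_iff'.1 hρle s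
  haveI : IsLocallyFiniteMeasure ρ := Measure.isLocallyFiniteMeasure_of_le hρle
  -- (1b) invariance under the dense set of translations `ℚ r`
  have hinv : ∀ (p : ℚ) (s ℓ : ℝ), ρ (Ioo (s + p * r) (s + p * r + ℓ)) = ρ (Ioo s (s + ℓ)) := by
    intro p s ℓ
    set d : ℝ := (p : ℝ) * r with hd
    rw [hρ, Measure.restrict_apply measurableSet_Ioo, Measure.restrict_apply measurableSet_Ioo]
    have hset : Ioo (s + d) (s + d + ℓ) ∩ A = (fun x => x + -d) ⁻¹' (Ioo s (s + ℓ) ∩ A) := by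
      ext x
      simp only [mem_inter_iff, mem_Ioo, mem_preimage, hA, mem_singleton_iff]
      have hφ : φ (x + -d) = φ x := by
        rw [map_add, map_neg, hd, hker p, neg_zero, add_zero]
      rw [hφ]
      constructor
      · rintro ⟨⟨h1, h2⟩, h3⟩; exact ⟨⟨by linarith, by linarith⟩, h3⟩
      · rintro ⟨⟨h1, h2⟩, h3⟩; exact ⟨⟨by linarith, by linarith⟩, h3⟩
    rw [hset, measure_preimage_add_right]
  -- (1c) continuity in the left endpoint
  have hcont : ∀ (s s' ℓ : ℝ), ρ (Ioo s (s + ℓ)) ≤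
      ρ (Ioo s' (s' + ℓ)) + ENNReal.ofReal |s' - s| + ENNReal.ofReal |s' - s| := by
    intro s s' ℓ
    have hsub : Ioo s (s + ℓ) ⊆ Ioo s' (s' + ℓ) ∪ uIcc s s' ∪ uIcc (s + ℓ) (s' + ℓ) := by
      intro x hx
      by_cases h1 : x ≤ s'
      · exact Or.inl (Or.inr (mem_uIcc.2 (Or.inl ⟨hx.1.le, h1⟩)))
      · by_cases h2 : s' + ℓ ≤ x
        · exact Or.inr (mem_uIcc.2 (Or.inr ⟨h2, hx.2.le⟩))
        · exact Or.inl (Or.inl ⟨lt_of_not_ge h1, lt_of_not_ge h2⟩)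
    calc ρ (Ioo s (s + ℓ)) ≤ ρ (Ioo s' (s' + ℓ) ∪ uIcc s s' ∪ uIcc (s + ℓ) (s' + ℓ)) :=
          measure_mono hsub
      _ ≤ ρ (Ioo s' (s' + ℓ) ∪ uIcc s s') + ρ (uIcc (s + ℓ) (s' + ℓ)) := measure_union_le _ _
      _ ≤ ρ (Ioo s' (s' + ℓ)) + ρ (uIcc s s') + ρ (uIcc (s + ℓ) (s' + ℓ)) := by
          gcongr; exact measure_union_le _ _
      _ ≤ ρ (Ioo s' (s' + ℓ)) + volume (uIcc s s') + volume (uIcc (s + ℓ) (s' + ℓ)) := by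
          gcongr
      _ = ρ (Ioo s' (s' + ℓ)) + ENNReal.ofReal |s' - s| + ENNReal.ofReal |s' - s| := by
          rw [Real.volume_interval, Real.volume_interval, show s' + ℓ - (s + ℓ) = s' - s by ring]
  -- finiteness
  have hfin : ∀ s ℓ : ℝ, ρ (Ioo s (s + ℓ)) < ⊤ := fun s ℓ =>
    (hρle' _).trans_lt (by rw [Real.volume_Ioo]; exact ENNReal.ofReal_lt_top)
  -- (1d) constancy in the left endpoint
  have hconst : ∀ (s ℓ : ℝ), ρ (Ioo s (s + ℓ)) = ρ (Ioo 0 (0 + ℓ)) := by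
    -- approximation: for every `s` and `ε > 0` a rational multiple of `r` within `ε` of `s`
    have happrox : ∀ (s ε : ℝ), 0 < ε → ∃ p : ℚ, |(p : ℝ) * r - s| < ε := by
      intro s ε hε
      have hr' : 0 < |r| := abs_pos.2 hr
      obtain ⟨p, hp1, hp2⟩ := exists_rat_btwn (show s / r - ε / |r| < s / r + ε / |r| by
        have : 0 < ε / |r| := div_pos hε hr'; linarith)
      refine ⟨p, ?_⟩
      have h1 : |(p : ℝ) - s / r| < ε / |r| := by rw [abs_lt]; constructor <;> linarith
      have h2 : (p : ℝ) * r - s = ((p : ℝ) - s / r) * r := by field_simp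
      rw [h2, abs_mul]
      calc |(p : ℝ) - s / r| * |r| < ε / |r| * |r| := by gcongr
        _ = ε := div_mul_cancel₀ ε hr'.ne'
    -- one-sided bounds
    have hle : ∀ (s s' ℓ : ℝ), ρ (Ioo s (s + ℓ)) ≤ ρ (Ioo s' (s' + ℓ)) := by
      intro s s' ℓ
      refine ENNReal.le_of_forall_pos_le_add fun ε hε _ => ?_
      obtain ⟨p, hp⟩ := happrox (s - s') (ε / 2) (by positivity)
      -- translate `s'` by `p r`: lands within `ε/2` of `s`
      have h1 := hcont s (s' + p * r) ℓ
      rw [hinv p s' ℓ] at h1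
      have h2 : ENNReal.ofReal |s' + p * r - s| ≤ (ε / 2 : NNReal) := by
        have : |s' + (p : ℝ) * r - s| < ε / 2 := by
          rw [show s' + (p : ℝ) * r - s = (p : ℝ) * r - (s - s') by ring]; exact hp
        rw [ENNReal.ofReal_le_iff_le_toReal ENNReal.coe_ne_top]
        simpa using this.le
      calc ρ (Ioo s (s + ℓ)) ≤ ρ (Ioo s' (s' + ℓ)) + ENNReal.ofReal |s' + ↑p * r - s| +
            ENNReal.ofReal |s' + ↑p * r - s| := h1
        _ ≤ ρ (Ioo s' (s' + ℓ)) + (ε / 2 : NNReal) + (ε / 2 : NNReal) := by gcongr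
        _ = ρ (Ioo s' (s' + ℓ)) + ε := by
            rw [add_assoc, ← ENNReal.coe_add, add_halves]
    intro s ℓ
    exact le_antisymm (hle s 0 ℓ) (hle 0 s ℓ)
  -- (1e) additivity
  have hadd : ∀ (a b c : ℝ), a ≤ b → b ≤ c → ρ (Ioo a c) = ρ (Ioo a b) + ρ (Ioo b c) := by
    intro a b c hab hbc
    rcases eq_or_lt_of_le hbc with rfl | hbc'
    · simp
    have h1 : ρ (Ioo a b) = ρ (Ioc a b) := measure_congr Ioo_ae_eq_Ioc
    have hdisj : Disjoint (Ioc a b) (Ioo b c) :=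
      Set.disjoint_left.2 fun x (hx : x ∈ Ioc a b) (hx' : x ∈ Ioo b c) => (not_lt.2 hx.2) hx'.1
    rw [← Ioc_union_Ioo_eq_Ioo hab hbc', measure_union hdisj measurableSet_Ioo, h1]
  -- the length function
  have hGdef : ∀ s ℓ, ρ (Ioo s (s + ℓ)) = ρ (Ioo 0 ℓ) := fun s ℓ => by
    rw [hconst s ℓ, zero_add]
  have hGnat : ∀ (n : ℕ) (a : ℝ), 0 ≤ a → ρ (Ioo 0 (n * a)) = n * ρ (Ioo 0 a) := by
    intro n a ha
    induction n with
    | zero => simp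
    | succ n ih =>
      have h1 : (0 : ℝ) ≤ n * a := by positivity
      rw [Nat.cast_succ, add_mul, one_mul, hadd 0 (n * a) (n * a + a) h1 (by linarith), ih,
        hGdef (n * a) a, Nat.cast_succ, add_mul, one_mul]
  set c : ENNReal := ρ (Ioo 0 1) with hc
  have hcfin : c ≠ ⊤ := by
    have := hfin 0 1
    rw [zero_add] at this
    exact this.ne
  have hGinv : ∀ n : ℕ, 0 < n → ρ (Ioo 0 (1 / n)) = c / n := by
    intro n hn
    rw [ENNReal.eq_div_iff (by exact_mod_cast hn.ne') (ENNReal.natCast_ne_top n)]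
    rw [← hGnat n (1 / n) (by positivity), mul_one_div_cancel (by exact_mod_cast hn.ne')]
  have hGrat : ∀ (m n : ℕ), 0 < n → ρ (Ioo 0 ((m : ℝ) / n)) = c * ((m : ENNReal) / n) := by
    intro m n hn
    rw [div_eq_mul_one_div, hGnat m _ (by positivity), hGinv n hn, ← mul_div_assoc,
      mul_comm (m : ENNReal) c, mul_div_assoc]
  -- (1g) the measure of rational intervals
  have hIoo : ∀ a b : ℚ, ρ (Ioo a b) = (c • (volume : Measure ℝ)) (Ioo a b) := by
    intro a b
    rw [Measure.smul_apply, smul_eq_mul, Real.volume_Ioo]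
    rcases le_or_gt b a with hba | hab
    · have hba' : (b : ℝ) ≤ a := by exact_mod_cast hba
      rw [Ioo_eq_empty (not_lt.2 hba'), measure_empty, ENNReal.ofReal_of_nonpos (by linarith),
        mul_zero]
    · set t : ℚ := b - a with ht
      have htpos : 0 < t := by rw [ht]; linarith
      have hnum : 0 < t.num := Rat.num_pos.2 htpos
      set m : ℕ := t.num.natAbs with hm
      set n : ℕ := t.den with hn
      have hnpos : 0 < n := t.den_pos
      have htR : ((b : ℝ) - a) = (m : ℝ) / n := by
        have h1 : ((b : ℝ) - a) = ((t : ℚ) : ℝ) := by rw [ht]; push_cast; ring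
        have h2 : (t.num : ℝ) = (m : ℝ) := by
          have : (m : ℤ) = t.num := by rw [hm]; exact Int.natAbs_of_nonneg hnum.le
          rw [← this]; simp
        rw [h1, Rat.cast_def, h2]
      have h3 : Ioo (a : ℝ) b = Ioo (a : ℝ) (a + ((b : ℝ) - a)) := by congr 1; ring
      rw [h3, hGdef, htR, hGrat m n hnpos, ENNReal.ofReal_div_of_pos (by exact_mod_cast hnpos),
        ENNReal.ofReal_natCast, ENNReal.ofReal_natCast]
  -- (1h) `ρ = c • volume`
  have hρc : ρ = c • (volume : Measure ℝ) := Real.measure_ext_Ioo_rat hIoo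
  -- (1i) conclusion
  set B : Set ℝ := toMeasurable (volume : Measure ℝ) A with hB
  have hBm : MeasurableSet B := measurableSet_toMeasurable _ _
  have hρB : ρ Bᶜ = 0 := by
    rw [hρ, Measure.restrict_apply hBm.compl]
    exact measure_mono_null (fun x hx => hx.1 (subset_toMeasurable _ _ hx.2))
      (measure_empty (μ := (volume : Measure ℝ)))
  have hmul : c * volume Bᶜ = 0 := by
    have := hρB
    rw [hρc, Measure.smul_apply, smul_eq_mul] at this
    exact this
  rcases mul_eq_zero.1 hmul with hc0 | hB0
  · -- `c = 0` is absurd: `A` has positive outer measure (its translates cover `ℝ`)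
    exfalso
    have hρ0 : ρ = 0 := by rw [hρc, hc0, zero_smul]
    have hA0 : volume A = 0 := by
      have := congrArg (fun μ : Measure ℝ => μ univ) hρ0
      simp only [Measure.coe_zero, Pi.zero_apply] at this
      rwa [hρ, Measure.restrict_apply MeasurableSet.univ, univ_inter] at this
    obtain ⟨x₁, hx₁⟩ := hsurj 1
    have hfib : ∀ q' : ℚ, volume (φ ⁻¹' {q'}) = 0 := by
      intro q'
      have hset : φ ⁻¹' {q'} = (fun x => x + ((q - q' : ℚ) : ℝ) * x₁) ⁻¹' A := by
        ext x
        simp only [mem_preimage, mem_singleton_iff, hA]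
        rw [← Rat.smul_def, map_add, map_smul, hx₁, smul_eq_mul, mul_one]
        constructor
        · intro h; rw [h]; ring
        · intro h; linear_combination h
      rw [hset, measure_preimage_add_right]
      exact hA0
    have huniv : (univ : Set ℝ) ⊆ ⋃ q' : ℚ, φ ⁻¹' {q'} := fun x _ => mem_iUnion.2 ⟨φ x, rfl⟩
    have h0 : volume (univ : Set ℝ) = 0 := measure_mono_null huniv (measure_iUnion_null hfib)
    rw [Real.volume_univ] at h0
    exact ENNReal.top_ne_zero h0
  · -- `volume Bᶜ = 0`: `A` has full outer measure
    ext S hS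
    rw [hρ, Measure.restrict_apply hS, inter_comm, ← Measure.measure_toMeasurable_inter_of_sFinite hS A]
    change volume (B ∩ S) = volume S
    refine le_antisymm (measure_mono inter_subset_right) ?_
    calc volume S ≤ volume (S ∩ B) + volume (S \ B) := by
          rw [measure_inter_add_sdiff S hBm]
      _ ≤ volume (S ∩ B) + volume Bᶜ := by
          gcongr; exact fun x hx => hx.2
      _ = volume (B ∩ S) := by rw [hB0, add_zero, inter_comm]

/-- **A countable partition of `ℝ` into thick sets.** There is a class map `k : ℝ → ℕ` every
fibre of which has full outer Lebesgue measure on every measurable set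
(`volume.restrict (k ⁻¹' {n}) = volume` for all `n`; in particular every fibre is non-empty and
non-measurable): the fibres of a Hamel coordinate `φ : ℝ → ℚ` composed with an enumeration
`ℚ ≃ ℕ` (Kharazishvili 2005, Ch. 9, Exercise 6; thickness by `restrict_fibre_eq_volume`). [cite: Kharazishvili2005, Ch. 9 Exercise 6] -/
theorem exists_classMap_restrict_eq_volume :
    ∃ k : ℝ → ℕ, ∀ n, (volume : Measure ℝ).restrict (k ⁻¹' {n}) = volume := by
  obtain ⟨φ, r, hr, hker, hsurj⟩ := exists_ratLinear_surjective
  refine ⟨fun t => Denumerable.eqv ℚ (φ t), fun n => ?_⟩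
  have hset : (fun t => Denumerable.eqv ℚ (φ t)) ⁻¹' {n} = φ ⁻¹' {(Denumerable.eqv ℚ).symm n} := by
    ext t
    simp only [mem_preimage, mem_singleton_iff]
    exact Equiv.apply_eq_iff_eq_symm_apply _
  rw [hset]
  exact restrict_fibre_eq_volume hr hker hsurj _

/-- **Measurability of a lift along a thick partition forces the branches to agree.** Let
`k : ℝ → ℕ` have thick fibres (`volume.restrict (k ⁻¹' {n}) = volume`), let `e n : ℝ → ℝ` be
measurable functions, and suppose the lift `t ↦ e (k t) t` is a.e.-strongly measurable on a
measurable set `S`. Then `e i = e j` a.e. on `S` for all `i`, `j`: if `ζ` is a measurable version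
of the lift, the measurable set `{e i ≠ ζ} ∩ S` meets the thick fibre `k ⁻¹' {i}` only inside the
null set where the lift differs from `ζ`, hence is null; so `e i = ζ = e j` a.e. on `S`.
Contrapositive use: a lift whose branches differ on a set of positive measure is not
a.e.-strongly measurable, and its Bochner integral is Mathlib's junk value `0`. [folklore] -/
theorem ae_eq_of_aestronglyMeasurable_lift {k : ℝ → ℕ}
    (hk : ∀ n, (volume : Measure ℝ).restrict (k ⁻¹' {n}) = volume)
    {e : ℕ → ℝ → ℝ} (he : ∀ n, Measurable (e n)) {S : Set ℝ} (hS : MeasurableSet S)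
    (h : AEStronglyMeasurable (fun t => e (k t) t) ((volume : Measure ℝ).restrict S)) (i j : ℕ) :
    e i =ᵐ[(volume : Measure ℝ).restrict S] e j := by
  obtain ⟨ζ, hζm, hζ⟩ := h
  set N : Set ℝ := {t | e (k t) t ≠ ζ t} with hN
  have hN0 : volume (N ∩ S) = 0 := by
    have : ((volume : Measure ℝ).restrict S) N = 0 := by
      rw [Filter.EventuallyEq, ae_iff] at hζ
      exact hζ
    rwa [Measure.restrict_apply' hS] at this
  have hζm' : Measurable ζ := hζm.measurable
  -- the exceptional sets
  have hcl : ∀ l : ℕ, volume ({t | e l t ≠ ζ t} ∩ S) = 0 := by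
    intro l
    have hmeas : MeasurableSet {t | e l t ≠ ζ t} := (measurableSet_eq_fun (he l) hζm').compl
    have h1 : ((volume : Measure ℝ).restrict S) {t | e l t ≠ ζ t} =
        (((volume : Measure ℝ).restrict (k ⁻¹' {l})).restrict S) {t | e l t ≠ ζ t} := by
      rw [hk l]
    rw [Measure.restrict_apply' hS, Measure.restrict_restrict hS,
      Measure.restrict_apply hmeas] at h1
    rw [h1]
    refine measure_mono_null ?_ hN0
    intro t ht
    obtain ⟨ht1, ht2, ht3⟩ := ht
    simp only [mem_preimage, mem_singleton_iff] at ht3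
    refine ⟨?_, ht2⟩
    show e (k t) t ≠ ζ t
    rw [ht3]; exact ht1
  rw [Filter.EventuallyEq, ae_iff, Measure.restrict_apply' hS]
  refine measure_mono_null (fun t ht => ?_) (measure_union_null (hcl i) (hcl j))
  obtain ⟨hne, htS⟩ := ht
  by_cases hi : e i t = ζ t
  · refine Or.inr ⟨?_, htS⟩
    show e j t ≠ ζ t
    rw [← hi]; exact Ne.symm hne
  · exact Or.inl ⟨hi, htS⟩

end Literature.MeasureTheory.Lebesgue.ThickPartition
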